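import Summits.RiemannHypothesis.RiemannHypothesis.Theses.LiPrimeEcho
import Summits.RiemannHypothesis.RiemannHypothesis.Theorems.LiPrimeEchoPolarEdge
import Summits.RiemannHypothesis.RiemannHypothesis.Theorems.LiPrimeEchoWindowAdjust
import HarnessLib

/-!
# RiemannHypothesis / LiPrimeEcho — the ASSEMBLY (RH-FREE bookkeeping)

RH-FREE [rh-li-prover].  Route `Theses/LiPrimeEcho.lean` (rung «Li PRIME-ECHO LAW» `LiTheory.LiZeroWindowEcho`, L-P(P1e);
cell `pub/rh-li`, theory memo `theory/TARGETS.md` §7.10 / §12), item `Assembly` (stmt-RiemannHypothesis-19249):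

  `LiWindowContour → LiPrimeEdgeEcho → LiGammaShift → LiHorizontalEdges → LiTheory.LiZeroWindowEcho`.

Proof = the theory seat's kernel-checked composition `liZeroWindowEcho_of` / `assembly_of_supports`
(HOME/theory/route/p4/SketchAll.lean, rh-li-theory g6), fed with the two landed RH-FREE skeleton statements
`liPolarEdgeBound` (polar piece `O(1)`, `Theorems/LiPrimeEchoPolarEdge.lean`) and `liWindowAdjust` (window ends,
`O(log n)`, `Theorems/LiPrimeEchoWindowAdjust.lean`): pick good heights `T₁ ∈ [√n, √n + 1]`, `T₂ ∈ [c√n, c√n + 1]`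
(K3), write the window zero trace at `(T₁, T₂]` by the contour identity (K1), replace the gamma edge by the smooth
mean (K4), the prime edge by the echo `E₂(n)` (K2), bound the polar edge (C) and the two horizontal edges (K3), and
move the window back to `(√n, c√n]` (G); every sign and constant is checked by `linarith`, and "for all large `n`"
becomes "for all `n ≥ 2`" with a worse constant (`eventually_to_all`).  Nothing here bears on the truth of RH.
-/

noncomputable section

-- D-0017: `Summit.<S>.<S>.…` is the designed namespace of a single-problem summit.
set_option linter.dupNamespace false

namespace Summit.RiemannHypothesis.RiemannHypothesis.Theorems.LiTheory

open Summit.RiemannHypothesis.RiemannHypothesis.Theses.LiPrimeEcho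

namespace PrimeEchoAssembly

/-- Bookkeeping: "for all large `n`" ⇒ "for all `n ≥ 2`" with a worse constant. -/
theorem eventually_to_all (f : ℕ → ℝ) :
    ∀ (N : ℕ) (C : ℝ), (∀ n : ℕ, N ≤ n → 2 ≤ n → |f n| ≤ C * Real.log n ^ 2) →
      ∃ C' : ℝ, ∀ n : ℕ, 2 ≤ n → |f n| ≤ C' * Real.log n ^ 2 := by
  intro N
  induction N with
  | zero => exact fun C h ↦ ⟨C, fun n hn ↦ h n (Nat.zero_le n) hn⟩
  | succ N ih =>
    intro C h
    by_cases hN : 2 ≤ N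
    · have hlogpos : 0 < Real.log N ^ 2 := by
        have h1 : (1 : ℝ) < N := by exact_mod_cast hN
        exact pow_pos (Real.log_pos h1) 2
      refine ih (max C (|f N| / Real.log N ^ 2)) fun n hn h2 ↦ ?_
      rcases Nat.eq_or_lt_of_le hn with h' | h'
      · subst h'
        calc |f N| = |f N| / Real.log N ^ 2 * Real.log N ^ 2 := (div_mul_cancel₀ _ hlogpos.ne').symm
          _ ≤ max C (|f N| / Real.log N ^ 2) * Real.log N ^ 2 :=
            mul_le_mul_of_nonneg_right (le_max_right _ _) hlogpos.le
      · exact (h n h' h2).trans (mul_le_mul_of_nonneg_right (le_max_left _ _) (sq_nonneg _))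
    · exact ih C fun n hn h2 ↦ h n (by omega) h2

/-- **COMPOSITION** (theory seat's `liZeroWindowEcho_of`): K1 (contour identity) + C (polar bound) + K4 (gamma shift)
+ K2 (prime echo) + K3 (horizontal edges at good heights) + G (window adjustment) ⇒ the leaf. -/
theorem liZeroWindowEcho_of (hA : LiWindowContour)
    (hC : ∀ c : ℝ, 1 ≤ c → ∃ C : ℝ, ∀ n : ℕ, 1 ≤ n → ∀ T₁ T₂ : ℝ, Real.sqrt n ≤ T₁ → T₁ ≤ T₂ →
      T₂ ≤ c * Real.sqrt n + 1 → |liPolarEdge n T₁ T₂| ≤ C)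
    (hD : LiGammaShift) (hE : LiPrimeEdgeEcho) (hF : LiHorizontalEdges)
    (hG : ∀ c : ℝ, 1 ≤ c → ∃ N : ℕ, ∃ C : ℝ, ∀ n : ℕ, N ≤ n → ∀ T₁ T₂ : ℝ, Real.sqrt n ≤ T₁ →
      T₁ ≤ Real.sqrt n + 1 → c * Real.sqrt n ≤ T₂ → T₂ ≤ c * Real.sqrt n + 1 →
      |liZeroTraceWindow n (Real.sqrt n) (c * Real.sqrt n) - liZeroTraceWindow n T₁ T₂| ≤ C * Real.log n ∧
      |liSmoothTraceWindow n (Real.sqrt n) (c * Real.sqrt n) - liSmoothTraceWindow n T₁ T₂| ≤ C * Real.log n) :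
    LiZeroWindowEcho := by
  intro c hc
  have hc1 : (1 : ℝ) ≤ c := by linarith
  obtain ⟨C₃, h3⟩ := hC c hc1
  obtain ⟨N₄, C₄, h4⟩ := hD c hc1
  obtain ⟨N₅, C₅, h5⟩ := hE c hc
  obtain ⟨N₆, C₆, h6⟩ := hF c hc1
  obtain ⟨N₇, C₇, h7⟩ := hG c hc1
  set ℓ : ℝ := Real.log 2 with hℓ_def
  have hℓ : 0 < ℓ := Real.log_pos (by norm_num)
  refine eventually_to_all _ (max (max (max N₄ N₅) (max N₆ N₇)) 64)
    ((2 * |C₇| + |C₄|) / ℓ + |C₃| / ℓ ^ 2 + 2 * |C₆| + |C₅|) fun n hn h2 ↦ ?_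
  have hn4 : N₄ ≤ n := by omega
  have hn5 : N₅ ≤ n := by omega
  have hn6 : N₆ ≤ n := by omega
  have hn7 : N₇ ≤ n := by omega
  have h64 : (64 : ℝ) ≤ n := by exact_mod_cast (show 64 ≤ n by omega)
  set s : ℝ := Real.sqrt n with hs_def
  have hs8 : 8 ≤ s := by
    have : Real.sqrt 64 = 8 := by
      rw [show (64 : ℝ) = 8 ^ 2 by norm_num]; exact Real.sqrt_sq (by norm_num)
    rw [← this]; exact Real.sqrt_le_sqrt h64
  have hs0 : 0 ≤ s := Real.sqrt_nonneg _
  have hcs : s ≤ c * s := le_mul_of_one_le_left hs0 hc1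
  have hgap : 2 ≤ (c - 1) * s := by
    have := mul_le_mul (show (1 / 4 : ℝ) ≤ c - 1 by linarith) hs8 (by norm_num) (by linarith)
    linarith
  obtain ⟨T₁, hT₁l, hT₁u, hgood₁, hH₁⟩ := h6 n hn6 s le_rfl hcs
  obtain ⟨T₂, hT₂l, hT₂u, hgood₂, hH₂⟩ := h6 n hn6 (c * s) hcs le_rfl
  have hlt : T₁ < T₂ := by nlinarith
  have hid := hA n T₁ T₂ (by linarith) hlt hgood₁ hgood₂
  have hpol := h3 n (by omega) T₁ T₂ hT₁l hlt.le hT₂u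
  have hgam := h4 n hn4 T₁ T₂ hT₁l hlt hT₂u
  have hpr := h5 n hn5 T₁ T₂ hT₁l hT₁u hT₂l hT₂u
  obtain ⟨hadjZ, hadjS⟩ := h7 n hn7 T₁ T₂ hT₁l hT₁u hT₂l hT₂u
  have key : liZeroTraceWindow n s (c * s) - liSmoothTraceWindow n s (c * s) + liPrimeEcho 2 n
      = (liZeroTraceWindow n s (c * s) - liZeroTraceWindow n T₁ T₂)
        - (liSmoothTraceWindow n s (c * s) - liSmoothTraceWindow n T₁ T₂)
        + liPolarEdge n T₁ T₂ + (liGammaEdge n T₁ T₂ - liSmoothTraceWindow n T₁ T₂)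
        - (liPrimeEdge n T₁ T₂ - liPrimeEcho 2 n) + liHorizTerm n T₁ - liHorizTerm n T₂ := by
    rw [hid]; ring
  rw [key]
  set L : ℝ := Real.log n with hL_def
  have hLℓ : ℓ ≤ L := Real.log_le_log (by norm_num) (by exact_mod_cast h2)
  have hL0 : 0 ≤ L := hℓ.le.trans hLℓ
  have hL2 : L ≤ L ^ 2 / ℓ := by
    rw [le_div_iff₀ hℓ, sq]; exact mul_le_mul_of_nonneg_left hLℓ hL0
  have hL1 : (1 : ℝ) ≤ L ^ 2 / ℓ ^ 2 := by
    rw [one_le_div (by positivity)]; exact pow_le_pow_left₀ hℓ.le hLℓ 2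
  have b1 : C₇ * L ≤ |C₇| * (L ^ 2 / ℓ) :=
    (mul_le_mul_of_nonneg_right (le_abs_self C₇) hL0).trans (mul_le_mul_of_nonneg_left hL2 (abs_nonneg _))
  have b3 : C₃ ≤ |C₃| * (L ^ 2 / ℓ ^ 2) :=
    (le_abs_self C₃).trans (le_mul_of_one_le_right (abs_nonneg _) hL1)
  have b4 : C₄ * L ≤ |C₄| * (L ^ 2 / ℓ) :=
    (mul_le_mul_of_nonneg_right (le_abs_self C₄) hL0).trans (mul_le_mul_of_nonneg_left hL2 (abs_nonneg _))
  have b5 : C₅ * L ^ 2 ≤ |C₅| * L ^ 2 := mul_le_mul_of_nonneg_right (le_abs_self C₅) (sq_nonneg _)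
  have b6 : C₆ * L ^ 2 ≤ |C₆| * L ^ 2 := mul_le_mul_of_nonneg_right (le_abs_self C₆) (sq_nonneg _)
  have e : ((2 * |C₇| + |C₄|) / ℓ + |C₃| / ℓ ^ 2 + 2 * |C₆| + |C₅|) * L ^ 2
      = 2 * (|C₇| * (L ^ 2 / ℓ)) + |C₄| * (L ^ 2 / ℓ) + |C₅| * L ^ 2
        + |C₃| * (L ^ 2 / ℓ ^ 2) + 2 * (|C₆| * L ^ 2) := by
    field_simp
    ring
  rw [e]
  rw [abs_le] at hadjZ hadjS hpol hgam hpr hH₁ hH₂ ⊢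
  constructor <;> linarith [hadjZ.1, hadjZ.2, hadjS.1, hadjS.2, hpol.1, hpol.2, hgam.1, hgam.2,
    hpr.1, hpr.2, hH₁.1, hH₁.2, hH₂.1, hH₂.2]

end PrimeEchoAssembly

/-- **Item `Assembly` of route `LiPrimeEcho`** (stmt-RiemannHypothesis-19249; RH-FREE bookkeeping), closed BY NAME:
the theory seat's composition fed with the landed skeleton statements `liPolarEdgeBound` and `liWindowAdjust`. -/
theorem liPrimeEcho_assembly_proof : Summit.RiemannHypothesis.RiemannHypothesis.Theses.LiPrimeEcho.Assembly :=
  fun h1 h2 h4 h5 ↦ PrimeEchoAssembly.liZeroWindowEcho_of h1 liPolarEdgeBound h4 h2 h5 liWindowAdjust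

end Summit.RiemannHypothesis.RiemannHypothesis.Theorems.LiTheory

end
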